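import Literature.AlgebraicGeometry.Resolution.VertexBlowupCharts
import Summits.ResolutionOfSingularities.ResolutionOfSingularities.Theorems.EquisingularLiftEquisingularLiftNatSpecimenQuarticTcDeltaLocalCharts
import Summits.ResolutionOfSingularities.ResolutionOfSingularities.Theorems.EquisingularLiftEquisingularLiftNatSpecimenQuarticPointStep
import Literature.AlgebraicGeometry.Resolution.AlterationsNormalFormBlowupFormalProofs
import Literature.AlgebraicGeometry.Resolution.NormalCrossingsLocal
import Literature.AlgebraicGeometry.Resolution.ProjectiveSpaceRegular
import Literature.AlgebraicGeometry.Resolution.IdealSheafLemmas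
import Literature.AlgebraicGeometry.Resolution.BlowupsLocal
import Literature.AlgebraicGeometry.Motives.ProjBasicOpenSubscheme
import HarnessLib

/-!
# [OURS · L1 W4.5(b) · EL♮(3)] SPECIMEN-Q DOWNSTAIRS, part E (1/2) — the (TC)-STEP ENGINE (charts, points, strict transform) on the charts of a blow-up of a scheme
# `X` at a closed point `x₀` with an affine neighbourhood `U ≅ Spec k[X₀, X₁, X₂]` centred at `x₀`
# (crux `EquisingularLiftNatThree` = stmt-ResolutionOfSingularities-20148, line `sections3`; res-L1-w45b-lead-2 CUT 2026-08-27T08:41:07Z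
# «SPECIMEN-Q DOWNSTAIRS» to res-D-pv-034 AS res-L1-s36-pv-3; helper `--supports … --as helper`, closes nothing)

HONEST FRAMING. OURS (cell `res-hironaka`, chain w45b, slot W4.5(b)); NOT a statement of any manuscript; AI-written, weaker
than expert review. Generic scheme plumbing (DeJong1996's `VertexBlowupCharts` pattern made base-agnostic) feeding the clauses of
the (TC) constructor of the registered stub `stub_elnat_tcDeltaPointResolution` (L/res-L1-w45b-lead-2/TARGET-T-ISO-0PLUS.lean):
«`¬ e ⊆ St(W)`», «`¬ St ⊆ Z`», «`Sing V(Z)_red` finite» for `Z = e ∩ St`.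

SETTING. `b : X' → X` a blow-up (`IsBlowup`) along the ideal sheaf of a CLOSED point `x₀`; `U` an affine open with
`e : Γ(X, U) ≅ k[X₀,X₁,X₂]` carrying `𝓘_{x₀}(U)` onto `(X₀,X₁,X₂)` (`hI`); a closed `T ⊆ X` with `𝓘_T(U) = (e⁻¹ f)` (read through
`fromSpec_mem_iff_of_ideal_eq` as `hT`). CONTENT: `exists_chartE` / `iSup_blowupChart_eq` (open immersions
`Spec k[X][𝔪/Xᵢ] → X'` covering `b⁻¹ U`, `IsBlowup.exists_chart_of_ringEquiv`); on a chart, `chart_apply_eq_iff` (over `x₀` iff the prime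
contains `Xᵢ/1`), `chart_apply_mem_iff`, `preimage_preimage_singleton` (`e = V(Xᵢ/1)`), `preimage_strictTransform_eq` (`St(T) = V(f′ᵢ)`
when `f = (Xᵢ/1)²f′ᵢ` with `f′ᵢ` prime, `f′ᵢ ∤ Xᵢ/1` — density of the generic point `(f′ᵢ)`), and the clause lemmas
`not_preimage_singleton_subset_strictTransform`, `not_strictTransform_subset_inter`, `isRegularLocalRing_inter_of_mem_range_chart`
(`V(Z)_red` regular over a chart where `√(Xᵢ/1, f′ᵢ) = J` with `k[X][𝔪/Xᵢ]/J` regular — generic `isRegularLocalRing_subscheme_of_chart`: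
`V(K.comap c) ≅ V(K) ×_{X'} Spec C → V(K)` open immersion, `V(J~) = Spec (C/J)`); `OpenChart`: the `(U, e)` data from an open-immersion
chart `u : Spec A → X` (`chartOpen`, `chartRingEquiv`, `map_ideal_chartOpen_eq`). The specimen's ring inputs are
`…SpecimenQuarticTcDeltaAmbientCharts` (p519832).

References: The Stacks Project, Tags 0804, 052Q, 080E; Hartshorne II Ex. 3.2.6, Prop. 5.9; Görtz–Wedhorn I (13.19), Prop. 13.91.
-/

set_option linter.dupNamespace false

noncomputable section

open CategoryTheory CategoryTheory.Limits AlgebraicGeometry TopologicalSpace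
open MvPolynomial
open Literature.AlgebraicGeometry.Resolution
open AlgebraicGeometry.Scheme.IdealSheafData
open Summit.ResolutionOfSingularities.ResolutionOfSingularities.Theorems.EquisingularLift

namespace Summit.ResolutionOfSingularities.ResolutionOfSingularities.Cruxes.EquisingularLiftNat.Sections

namespace SpecimenQuarticTcDelta

universe u

/-! ## Regularity of a closed subscheme read on an affine chart of the ambient scheme -/

/-- **Stalks of `V(K)` over an affine chart.** If `c : Spec C → X'` is an open immersion and `K` pulls back along `c` to the
ideal sheaf `J~` with `C/J` a regular ring, then `V(K)` is regular at every point lying over the image of `c`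
(`V(K.comap c) ≅ V(K) ×_{X'} Spec C → V(K)` is an open immersion, and `V(J~) = Spec (C/J)`). [cite: Hartshorne1977, II Prop. 5.9] -/
theorem isRegularLocalRing_subscheme_of_chart {X' : Scheme.{u}} (K : X'.IdealSheafData) {C : CommRingCat.{u}}
    (c : Spec C ⟶ X') [IsOpenImmersion c] (J : Ideal C)
    (hK : K.comap c = ofIdealTop (J.map (Scheme.ΓSpecIso C).inv.hom)) [hreg : IsRegularRing (C ⧸ J)]
    (z : K.subscheme) (hz : K.subschemeι z ∈ Set.range c) :
    IsRegularLocalRing (K.subscheme.presheaf.stalk z) := by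
  -- the open immersion `V(K.comap c) → V(K)` and a preimage of `z`
  let j : (K.comap c).subscheme ⟶ K.subscheme := (K.comapIso c).hom ≫ pullback.snd c K.subschemeι
  haveI : IsOpenImmersion j := inferInstance
  have hzj : z ∈ Set.range j := by
    have hz' : z ∈ Set.range (pullback.snd c K.subschemeι) := by
      rw [Scheme.Pullback.range_snd]; exact hz
    obtain ⟨y, hy⟩ := hz'
    refine ⟨(K.comapIso c).inv y, ?_⟩
    change ((K.comapIso c).inv ≫ (K.comapIso c).hom ≫ pullback.snd c K.subschemeι) y = z
    rw [Iso.inv_hom_id_assoc]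
    exact hy
  obtain ⟨z', rfl⟩ := hzj
  -- `V(K.comap c) = V(J~)` is covered by `Spec (Γ(Spec C, ⊤)/J~(⊤)) ≅ Spec (C/J)`, regular
  have hreg' : Scheme.IsRegular (K.comap c).subscheme := by
    rw [hK]
    apply Scheme.IsRegular.of_forall_exists_isOpenImmersion
    intro y
    let U : (Spec C).affineOpens := ⟨⊤, isAffineOpen_top _⟩
    refine ⟨_, (ofIdealTop (J.map (Scheme.ΓSpecIso C).inv.hom)).subschemeCover.f U, inferInstance, ?_, ?_⟩
    · rw [← Scheme.Hom.coe_opensRange, Scheme.IdealSheafData.opensRange_subschemeCover_map]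
      exact Opens.mem_top _
    · have hJ : (ofIdealTop (J.map (Scheme.ΓSpecIso C).inv.hom)).ideal U = J.map (Scheme.ΓSpecIso C).inv.hom :=
        ideal_ofIdealTop_top _
      have h1 : IsRegularRing (Γ(Spec C, (U : (Spec C).Opens)) ⧸ J.map (Scheme.ΓSpecIso C).inv.hom) :=
        IsRegularRing.of_ringEquiv (Ideal.quotientEquiv J (J.map (Scheme.ΓSpecIso C).inv.hom)
          (Scheme.ΓSpecIso C).symm.commRingCatIsoToRingEquiv rfl)
      have h2 : IsRegularRing (Γ(Spec C, (U : (Spec C).Opens)) ⧸ (ofIdealTop (J.map (Scheme.ΓSpecIso C).inv.hom)).ideal U) :=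
        @IsRegularRing.of_ringEquiv _ _ _ _ (Ideal.quotEquivOfEq hJ.symm) h1
      exact @Scheme.isRegular_Spec ((ofIdealTop (J.map (Scheme.ΓSpecIso C).inv.hom)).subschemeCover.X U) h2
  haveI := hreg' z'
  exact IsRegularLocalRing.of_ringEquiv (asIso (j.stalkMap z')).commRingCatIsoToRingEquiv.symm


/-! ## The charts of a blow-up of `X` at a closed point `x₀` with an affine neighbourhood `U ≅ Spec k[X₀, X₁, X₂]` centred at `x₀` -/

section Engine

variable {k : Type} [Field k]
variable {X X' : Scheme.{0}} {b : X' ⟶ X} (U : X.affineOpens) (e : Γ(X, U) ≃+* MvPolynomial (Fin 3) k)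
  {x₀ : X} (hx₀ : IsClosed ({x₀} : Set X))

/-- The structure map of the `i`-th chart: `Γ(X, U) ≅ k[X] → k[X][𝔪/Xᵢ]`. [cite: StacksProject, Tag 0804] -/
def toChartE (i : Fin 3) : Γ(X, U) →+* PointBlowup.Chart 2 k i :=
  (algebraMap (MvPolynomial (Fin 3) k) (PointBlowup.Chart 2 k i)).comp e.toRingHom

variable (hI : ((vanishingIdeal (⟨{x₀}, hx₀⟩ : Closeds X)).ideal U).map e.toRingHom = PointBlowup.originIdeal 2 k)

include hI in
/-- The ideal of the point on the chart is the pull-back of the ideal of the origin. [folklore] -/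
theorem ideal_point_eq_comap :
    (vanishingIdeal (⟨{x₀}, hx₀⟩ : Closeds X)).ideal U = (PointBlowup.originIdeal 2 k).comap e.toRingHom := by
  rw [← hI, Ideal.comap_map_of_bijective e.toRingHom (e.bijective : Function.Bijective e.toRingHom)]

include hI in
/-- `e⁻¹ Xᵢ` lies in the ideal of the point. [folklore] -/
theorem symm_X_mem (i : Fin 3) : e.symm (MvPolynomial.X i) ∈ (vanishingIdeal (⟨{x₀}, hx₀⟩ : Closeds X)).ideal U := by
  rw [ideal_point_eq_comap U e hx₀ hI, Ideal.mem_comap]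
  change e (e.symm (MvPolynomial.X i)) ∈ _
  rw [e.apply_symm_apply]
  exact Ideal.subset_span (Set.mem_range_self i)

include hI in
/-- The `e⁻¹ Xᵢ` generate the ideal of the point on the chart. [folklore] -/
theorem span_range_symm_X : Ideal.span (Set.range fun i : Fin 3 => e.symm (MvPolynomial.X i)) =
    (vanishingIdeal (⟨{x₀}, hx₀⟩ : Closeds X)).ideal U := by
  have h1 : ((vanishingIdeal (⟨{x₀}, hx₀⟩ : Closeds X)).ideal U) =
      (PointBlowup.originIdeal 2 k).map e.symm.toRingHom := by
    rw [← hI, Ideal.map_map]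
    have : e.symm.toRingHom.comp e.toRingHom = RingHom.id _ := by
      ext a; simp
    rw [this, Ideal.map_id]
  rw [h1, PointBlowup.originIdeal, Ideal.map_span, ← Set.range_comp]
  rfl

include hI in
/-- **The `i`-th chart of a blow-up of `X` at `x₀`**: an open immersion `Spec k[X][𝔪/Xᵢ] → X'` onto the principal chart
`X'[U, e⁻¹Xᵢ]`, lying over `Spec k[X][𝔪/Xᵢ] → Spec k[X] ≅ U ⊆ X` (DeJong1996.exists_vertexChart, generic base). [cite: StacksProject, Tag 0804] -/
theorem exists_chartE (hb : IsBlowup b (vanishingIdeal (⟨{x₀}, hx₀⟩ : Closeds X))) (i : Fin 3) :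
    ∃ (c : Spec (.of (PointBlowup.Chart 2 k i)) ⟶ X') (_ : IsOpenImmersion c),
      c.opensRange = blowupChart b (vanishingIdeal (⟨{x₀}, hx₀⟩ : Closeds X)) U (e.symm (MvPolynomial.X i)) ∧
        c ≫ b = Spec.map (CommRingCat.ofHom (toChartE U e i)) ≫ U.2.fromSpec :=
  hb.exists_chart_of_ringEquiv U (symm_X_mem U e hx₀ hI i) e (PointBlowup.originIdeal 2 k) (MvPolynomial.X i) hI
    (e.apply_symm_apply _)

include hI in
/-- The charts cover `b⁻¹ U`. [cite: StacksProject, Tag 0804] -/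
theorem iSup_blowupChart_eq (hb : IsBlowup b (vanishingIdeal (⟨{x₀}, hx₀⟩ : Closeds X))) :
    ⨆ i : Fin 3, blowupChart b (vanishingIdeal (⟨{x₀}, hx₀⟩ : Closeds X)) U (e.symm (MvPolynomial.X i)) = b ⁻¹ᵁ (U : X.Opens) :=
  hb.iSup_blowupChart (fun i : Fin 3 => e.symm (MvPolynomial.X i)) (span_range_symm_X U e hx₀ hI)

/-- `q ∈ V(t) ↔ t ∈ q` (bookkeeping across the `Spec`/`PrimeSpectrum` spellings). [folklore] -/
theorem mem_zeroLocus_singleton_iff {C : Type u} [CommRing C] (q : PrimeSpectrum C) (t : C) :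
    q ∈ PrimeSpectrum.zeroLocus ({t} : Set C) ↔ t ∈ q.asIdeal := by
  rw [PrimeSpectrum.mem_zeroLocus, Set.singleton_subset_iff, SetLike.mem_coe]

/-! ## Points on a chart -/

variable {U e}

/-- A point `r` of `Spec Γ(X, U)` maps to `x₀` iff its prime contains the ideal of the point. [folklore] -/
theorem fromSpec_apply_eq_iff (r : Spec Γ(X, U)) :
    U.2.fromSpec r = x₀ ↔ (vanishingIdeal (⟨{x₀}, hx₀⟩ : Closeds X)).ideal U ≤ r.asIdeal := by
  have hcl : IsClosed (U.2.fromSpec ⁻¹' ({x₀} : Set X)) := hx₀.preimage U.2.fromSpec.continuous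
  rw [vanishingIdeal_ideal]
  change r ∈ U.2.fromSpec ⁻¹' ({x₀} : Set X) ↔ PrimeSpectrum.vanishingIdeal (U.2.fromSpec ⁻¹' ({x₀} : Set X)) ≤ r.asIdeal
  set S : Set (Spec Γ(X, U)) := U.2.fromSpec ⁻¹' ({x₀} : Set X) with hS
  constructor
  · intro hr
    have h1 : r ∈ PrimeSpectrum.zeroLocus (PrimeSpectrum.vanishingIdeal S : Set Γ(X, U)) := by
      rw [PrimeSpectrum.zeroLocus_vanishingIdeal_eq_closure]; exact subset_closure hr
    exact fun a ha => (PrimeSpectrum.mem_zeroLocus _ _).mp h1 ha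
  · intro h
    have h1 : r ∈ PrimeSpectrum.zeroLocus (PrimeSpectrum.vanishingIdeal S : Set Γ(X, U)) :=
      (PrimeSpectrum.mem_zeroLocus _ _).mpr (fun a ha => h ha)
    rw [PrimeSpectrum.zeroLocus_vanishingIdeal_eq_closure] at h1
    exact hcl.closure_subset h1

/-- **Membership in a closed `T` read through the ideal of `T` on the chart**: if `𝓘_T(U) = (g)` then `fromSpec r ∈ T ↔ g ∈ r`.
[cite: Hartshorne1977, II Example 3.2.6] -/
theorem fromSpec_mem_iff_of_ideal_eq {T : Set X} (hTc : IsClosed T) {g : Γ(X, U)}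
    (hTI : (vanishingIdeal (⟨T, hTc⟩ : Closeds X)).ideal U = Ideal.span {g}) (r : Spec Γ(X, U)) :
    U.2.fromSpec r ∈ T ↔ g ∈ r.asIdeal := by
  have hcl : IsClosed (U.2.fromSpec ⁻¹' T) := hTc.preimage U.2.fromSpec.continuous
  have key : r ∈ U.2.fromSpec ⁻¹' T ↔ PrimeSpectrum.vanishingIdeal (U.2.fromSpec ⁻¹' T) ≤ r.asIdeal := by
    set S : Set (Spec Γ(X, U)) := U.2.fromSpec ⁻¹' T with hS
    constructor
    · intro hr
      have h1 : r ∈ PrimeSpectrum.zeroLocus (PrimeSpectrum.vanishingIdeal S : Set Γ(X, U)) := by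
        rw [PrimeSpectrum.zeroLocus_vanishingIdeal_eq_closure]; exact subset_closure hr
      exact fun a ha => (PrimeSpectrum.mem_zeroLocus _ _).mp h1 ha
    · intro h
      have h1 : r ∈ PrimeSpectrum.zeroLocus (PrimeSpectrum.vanishingIdeal S : Set Γ(X, U)) :=
        (PrimeSpectrum.mem_zeroLocus _ _).mpr (fun a ha => h ha)
      rw [PrimeSpectrum.zeroLocus_vanishingIdeal_eq_closure] at h1
      exact hcl.closure_subset h1
  have hideal : (vanishingIdeal (⟨T, hTc⟩ : Closeds X)).ideal U = PrimeSpectrum.vanishingIdeal (U.2.fromSpec ⁻¹' T) := by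
    rw [vanishingIdeal_ideal]; rfl
  change r ∈ U.2.fromSpec ⁻¹' T ↔ _
  rw [key, ← hideal, hTI, Ideal.span_le, Set.singleton_subset_iff, SetLike.mem_coe]

include hI in
/-- **On the `i`-th chart, a point lies over `x₀` iff its prime contains the exceptional generator `Xᵢ/1`.** [cite: StacksProject, Tag 0804] -/
theorem chart_apply_eq_iff {i : Fin 3} {c : Spec (.of (PointBlowup.Chart 2 k i)) ⟶ X'}
    (hc : c ≫ b = Spec.map (CommRingCat.ofHom (toChartE U e i)) ≫ U.2.fromSpec) (q : Spec (.of (PointBlowup.Chart 2 k i))) :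
    (c ≫ b) q = x₀ ↔ PointBlowup.exc 2 k i ∈ q.asIdeal := by
  rw [hc]
  change U.2.fromSpec (Spec.map (CommRingCat.ofHom (toChartE U e i)) q) = x₀ ↔ _
  rw [fromSpec_apply_eq_iff hx₀, Spec.map_apply]
  change (vanishingIdeal (⟨{x₀}, hx₀⟩ : Closeds X)).ideal U ≤ q.asIdeal.comap (toChartE U e i) ↔ _
  rw [← Ideal.map_le_iff_le_comap, toChartE, ← Ideal.map_map, hI, PointBlowup.map_originIdeal_eq_span, Ideal.span_le,
    Set.singleton_subset_iff, SetLike.mem_coe]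

/-- **On the `i`-th chart, membership in a closed `T` read through `U ≅ Spec k[X]`**: if `T ∩ U` is cut out by `f` in the sense
`fromSpec r ∈ T ↔ e⁻¹ f ∈ r`, then a chart point lies over `T` iff its prime contains `f`. [folklore] -/
theorem chart_apply_mem_iff {T : Set X} {f : MvPolynomial (Fin 3) k}
    (hT : ∀ r : Spec Γ(X, U), U.2.fromSpec r ∈ T ↔ e.symm f ∈ r.asIdeal)
    {i : Fin 3} {c : Spec (.of (PointBlowup.Chart 2 k i)) ⟶ X'}
    (hc : c ≫ b = Spec.map (CommRingCat.ofHom (toChartE U e i)) ≫ U.2.fromSpec) (q : Spec (.of (PointBlowup.Chart 2 k i))) :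
    (c ≫ b) q ∈ T ↔ algebraMap (MvPolynomial (Fin 3) k) (PointBlowup.Chart 2 k i) f ∈ q.asIdeal := by
  rw [hc]
  change U.2.fromSpec (Spec.map (CommRingCat.ofHom (toChartE U e i)) q) ∈ T ↔ _
  rw [hT, Spec.map_apply]
  change toChartE U e i (e.symm f) ∈ q.asIdeal ↔ _
  rw [toChartE, RingHom.comp_apply]
  change algebraMap _ _ (e (e.symm f)) ∈ q.asIdeal ↔ _
  rw [e.apply_symm_apply]

/-! ## The strict transform of `T` and the exceptional divisor on a chart -/

include hI in
/-- The exceptional divisor on the chart: `c⁻¹ b⁻¹{x₀} = V(Xᵢ/1)`. [cite: StacksProject, Tag 0804] -/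
theorem preimage_preimage_singleton {i : Fin 3} {c : Spec (.of (PointBlowup.Chart 2 k i)) ⟶ X'}
    (hc : c ≫ b = Spec.map (CommRingCat.ofHom (toChartE U e i)) ≫ U.2.fromSpec) :
    c ⁻¹' (b ⁻¹' {x₀}) = PrimeSpectrum.zeroLocus {PointBlowup.exc 2 k i} := by
  ext q
  rw [← Set.preimage_comp, ← TopCat.coe_comp, ← Scheme.Hom.comp_base, Set.mem_preimage, Set.mem_singleton_iff]
  exact (chart_apply_eq_iff hx₀ hI hc q).trans (mem_zeroLocus_singleton_iff q _).symm

include hI in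
/-- **The strict transform on the chart, first form**: `c⁻¹ closure(b⁻¹(T ∖ {x₀})) = closure (V(f) ∖ V(Xᵢ/1))`. [cite: StacksProject, Tag 080E] -/
theorem preimage_strictTransform_eq_closure {T : Set X} {f : MvPolynomial (Fin 3) k}
    (hT : ∀ r : Spec Γ(X, U), U.2.fromSpec r ∈ T ↔ e.symm f ∈ r.asIdeal)
    {i : Fin 3} {c : Spec (.of (PointBlowup.Chart 2 k i)) ⟶ X'} [IsOpenImmersion c]
    (hc : c ≫ b = Spec.map (CommRingCat.ofHom (toChartE U e i)) ≫ U.2.fromSpec) :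
    c ⁻¹' closure (b ⁻¹' (T \ {x₀})) =
      closure (PrimeSpectrum.zeroLocus {algebraMap (MvPolynomial (Fin 3) k) (PointBlowup.Chart 2 k i) f} \
        PrimeSpectrum.zeroLocus {PointBlowup.exc 2 k i}) := by
  rw [c.isOpenEmbedding.isOpenMap.preimage_closure_eq_closure_preimage c.continuous]
  congr 1
  ext q
  rw [← Set.preimage_comp, ← TopCat.coe_comp, ← Scheme.Hom.comp_base, Set.mem_preimage]
  change (c ≫ b) q ∈ T ∧ (c ≫ b) q ∉ ({x₀} : Set X) ↔ q ∈ _ ∧ q ∉ _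
  rw [Set.mem_singleton_iff, chart_apply_mem_iff hT hc, chart_apply_eq_iff hx₀ hI hc]
  exact Iff.and (mem_zeroLocus_singleton_iff q _).symm (Iff.not (mem_zeroLocus_singleton_iff q _).symm)

/-- Off the exceptional divisor, `V(Xᵢ² f′) = V(f′)`. [folklore] -/
theorem zeroLocus_diff_eq_of_factor {C : Type} [CommRing C] {g t f' : C} (hg : g = t ^ 2 * f') :
    PrimeSpectrum.zeroLocus {g} \ PrimeSpectrum.zeroLocus {t} =
      PrimeSpectrum.zeroLocus {f'} \ PrimeSpectrum.zeroLocus ({t} : Set C) := by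
  ext q
  simp only [Set.mem_sdiff, PrimeSpectrum.mem_zeroLocus, Set.singleton_subset_iff, SetLike.mem_coe]
  constructor
  · rintro ⟨h1, h2⟩
    refine ⟨?_, h2⟩
    rw [hg] at h1
    rcases q.isPrime.mem_or_mem h1 with h | h
    · exact absurd (q.isPrime.mem_of_pow_mem 2 h) h2
    · exact h
  · rintro ⟨h1, h2⟩
    exact ⟨by rw [hg]; exact Ideal.mul_mem_left _ _ h1, h2⟩

/-- `closure (V(f′) ∖ V(t)) ⊆ V(f′)`. [folklore] -/
theorem closure_zeroLocus_diff_subset {C : Type} [CommRing C] (f' t : C) :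
    closure (PrimeSpectrum.zeroLocus {f'} \ PrimeSpectrum.zeroLocus ({t} : Set C)) ⊆ PrimeSpectrum.zeroLocus {f'} :=
  closure_minimal Set.sdiff_subset (PrimeSpectrum.isClosed_zeroLocus _)

/-- **Density**: if `f′` is prime and does not divide `t`, the generic point `(f′)` of `V(f′)` lies off `V(t)`, so
`V(f′) = closure (V(f′) ∖ V(t))`. [folklore] -/
theorem zeroLocus_subset_closure_diff {C : Type} [CommRing C] {f' t : C} (hp : Prime f') (hnd : ¬ f' ∣ t) :
    PrimeSpectrum.zeroLocus {f'} ⊆ closure (PrimeSpectrum.zeroLocus {f'} \ PrimeSpectrum.zeroLocus ({t} : Set C)) := by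
  intro q hq
  let η : PrimeSpectrum C := ⟨Ideal.span {f'}, (Ideal.span_singleton_prime hp.ne_zero).mpr hp⟩
  have hη : η ∈ PrimeSpectrum.zeroLocus {f'} \ PrimeSpectrum.zeroLocus ({t} : Set C) := by
    refine ⟨(PrimeSpectrum.mem_zeroLocus _ _).mpr (Set.singleton_subset_iff.mpr (Ideal.mem_span_singleton_self _)), ?_⟩
    intro h
    exact hnd (Ideal.mem_span_singleton.mp (Set.singleton_subset_iff.mp ((PrimeSpectrum.mem_zeroLocus _ _).mp h)))
  have hle : η ⤳ q := by
    rw [← PrimeSpectrum.le_iff_specializes]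
    change Ideal.span {f'} ≤ q.asIdeal
    rw [Ideal.span_le]
    exact (PrimeSpectrum.mem_zeroLocus _ _).mp hq
  exact hle.mem_closed isClosed_closure (subset_closure hη)

include hI in
/-- **The strict transform on the chart**: with `f = (Xᵢ/1)² · f′ᵢ` on the chart, `f′ᵢ` prime not dividing `Xᵢ/1`,
`c⁻¹ closure(b⁻¹(T ∖ {x₀})) = V(f′ᵢ)`. [cite: StacksProject, Tag 080E] -/
theorem preimage_strictTransform_eq {T : Set X} {f : MvPolynomial (Fin 3) k}
    (hT : ∀ r : Spec Γ(X, U), U.2.fromSpec r ∈ T ↔ e.symm f ∈ r.asIdeal)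
    {i : Fin 3} {c : Spec (.of (PointBlowup.Chart 2 k i)) ⟶ X'} [IsOpenImmersion c]
    (hc : c ≫ b = Spec.map (CommRingCat.ofHom (toChartE U e i)) ≫ U.2.fromSpec)
    {f' : PointBlowup.Chart 2 k i}
    (hf : algebraMap (MvPolynomial (Fin 3) k) (PointBlowup.Chart 2 k i) f = PointBlowup.exc 2 k i ^ 2 * f')
    (hp : Prime f') (hnd : ¬ f' ∣ PointBlowup.exc 2 k i) :
    c ⁻¹' closure (b ⁻¹' (T \ {x₀})) = PrimeSpectrum.zeroLocus {f'} := by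
  rw [preimage_strictTransform_eq_closure hx₀ hI hT hc, zeroLocus_diff_eq_of_factor hf]
  exact le_antisymm (closure_zeroLocus_diff_subset _ _) (zeroLocus_subset_closure_diff hp hnd)

include hI in
/-- The strict transform on ANY chart lies in `V(f′ᵢ)` (no primality needed). [cite: StacksProject, Tag 080E] -/
theorem preimage_strictTransform_subset {T : Set X} {f : MvPolynomial (Fin 3) k}
    (hT : ∀ r : Spec Γ(X, U), U.2.fromSpec r ∈ T ↔ e.symm f ∈ r.asIdeal)
    {i : Fin 3} {c : Spec (.of (PointBlowup.Chart 2 k i)) ⟶ X'} [IsOpenImmersion c]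
    (hc : c ≫ b = Spec.map (CommRingCat.ofHom (toChartE U e i)) ≫ U.2.fromSpec)
    {f' : PointBlowup.Chart 2 k i}
    (hf : algebraMap (MvPolynomial (Fin 3) k) (PointBlowup.Chart 2 k i) f = PointBlowup.exc 2 k i ^ 2 * f') :
    c ⁻¹' closure (b ⁻¹' (T \ {x₀})) ⊆ PrimeSpectrum.zeroLocus {f'} := by
  rw [preimage_strictTransform_eq_closure hx₀ hI hT hc, zeroLocus_diff_eq_of_factor hf]
  exact closure_zeroLocus_diff_subset _ _


end Engine

end SpecimenQuarticTcDelta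

end Summit.ResolutionOfSingularities.ResolutionOfSingularities.Cruxes.EquisingularLiftNat.Sections
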